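import Mathlib.Analysis.InnerProductSpace.Basic
import Literature.Probability.RandomPlanarGeometry.PolygonLog
import HarnessLib

/-!
# Strictly star-shaped polygons are simple

A quantitative simplicity criterion for closed polygons, used for the boundary polygons of the
grid approximations `D^R` of a disc in the UST Peano curve scaling limit ([LSW04] §4.3; the
structure `USTPeano.Domain` demands `IsSimpleClosedPolygon`), on top of the logarithm along the
polygon of `PolygonLog.lean`:

* `IsSimpleClosedPolygon.of_injOn` — injectivity of `polygonLoop l` on `[0, 1)` gives the
  half-open-edge definition of simplicity (converse of `injOn_polygonLoop`);
* `isSimpleClosedPolygon_of_cross_pos` — **if every cyclic edge is seen strictly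
  counterclockwise from `z` (`cross > 0`), makes an acute angle at `z` (`⟪v_k - z, v_{k+1} - z⟫ > 0`, real inner product of `ℂ`), and
  `∑ cross_k/⟪·,·⟫_k < 4π`, the polygon is simple**: the winding number is an integer `≥ 1`
  (`one_le_wind_polygonLoop_sub`) equal to `(2π)⁻¹ ∑ arg w_k ≤ (2π)⁻¹ ∑ tan (arg w_k) < 2`, so it
  is `1`; then the imaginary part of the logarithm pins every parameter (on edge `k` it lies in
  `[∑_{r<k} arg w_r, ∑_{r≤k} arg w_r)`), so two parameters with the same point have logarithms
  differing by `2πi n` with `|2π n| < 2π`, hence equal, hence the same edge and fraction;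
* `isSimpleClosedPolygon_of_cross_pos_of_le_norm` — the convenient form for lattice polygons far
  from `z`: `‖v_k - z‖ ≥ r > 1`, unit edges, strictly counterclockwise, `N < 4π (r - 1)`
  (each `cross_k/⟪·,·⟫_k ≤ 1/(r - 1)`, by `norm_sq_sub_norm_le_inner`, `cross_le_norm`).
-/

noncomputable section

open Set Function Complex Finset
open Literature.Topology.PlaneTopology

namespace Literature.Probability.RandomPlanarGeometry

section Polygon

variable {l : List ℂ} {z : ℂ}

/-! ### Simplicity -/

/-! ### Inner products and cross products of unit steps -/

/-- `re (v / u) = ⟪u, v⟫ / ‖u‖²` (real inner product of `ℂ`). [folklore] -/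
theorem re_div_eq_inner_div (u v : ℂ) : (v / u).re = inner ℝ u v / Complex.normSq u := by
  rw [Complex.div_re, Complex.inner, Complex.mul_re, Complex.conj_re, Complex.conj_im]
  ring

/-- `⟪u, v⟫ = ‖u‖² + re (conj u · (v - u))`. [folklore] -/
theorem inner_eq_norm_sq_add (u v : ℂ) :
    inner ℝ u v = ‖u‖ ^ 2 + (starRingEnd ℂ u * (v - u)).re := by
  rw [Complex.inner, Complex.sq_norm, Complex.normSq_apply, Complex.mul_re, Complex.mul_re,
    Complex.conj_re, Complex.conj_im, Complex.sub_re, Complex.sub_im]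
  ring

/-- A unit step from a far point makes an acute angle: `‖v - u‖ ≤ 1` gives
`⟪u, v⟫ ≥ ‖u‖² - ‖u‖`. [folklore] -/
theorem norm_sq_sub_norm_le_inner {u v : ℂ} (hvu : ‖v - u‖ ≤ 1) : ‖u‖ ^ 2 - ‖u‖ ≤ inner ℝ u v := by
  rw [inner_eq_norm_sq_add]
  have h2 : |(starRingEnd ℂ u * (v - u)).re| ≤ ‖u‖ := by
    calc |(starRingEnd ℂ u * (v - u)).re| ≤ ‖starRingEnd ℂ u * (v - u)‖ := Complex.abs_re_le_norm _
      _ = ‖u‖ * ‖v - u‖ := by rw [norm_mul, Complex.norm_conj]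
      _ ≤ ‖u‖ := by nlinarith [norm_nonneg u, norm_nonneg (v - u)]
  have := (abs_le.1 h2).1
  linarith

/-- `cross u v = im (conj u · (v - u))`. [folklore] -/
theorem cross_eq_im (u v : ℂ) : cross u v = (starRingEnd ℂ u * (v - u)).im := by
  rw [cross, Complex.mul_im, Complex.conj_re, Complex.conj_im, Complex.sub_re, Complex.sub_im]
  ring

/-- **Injectivity of the loop gives the half-open-edge definition of simplicity.** [folklore] -/
theorem IsSimpleClosedPolygon.of_injOn {E : Type*} [AddCommGroup E] [Module ℝ E] {l : List E}
    (hl : 0 < l.length) (hinj : InjOn (polygonLoop l) (Ico 0 1)) : IsSimpleClosedPolygon l := by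
  have hN : (0 : ℝ) < l.length := by exact_mod_cast hl
  -- parameters of the half-open edge `k`
  have hparam : ∀ (k : ℕ) (hk : k < l.length) (θ : ℝ), θ ∈ Ico (0 : ℝ) 1 →
      ((k : ℝ) + θ) / l.length ∈ Ico (0 : ℝ) 1 ∧
        polygonLoop l (((k : ℝ) + θ) / l.length) =
          AffineMap.lineMap l[k] (l[(k + 1) % l.length]'(Nat.mod_lt _ hl)) θ := by
    intro k hk θ hθ
    refine ⟨⟨div_nonneg (by linarith [hθ.1]) hN.le, ?_⟩, polygonLoop_apply_div hk ⟨hθ.1, hθ.2.le⟩⟩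
    rw [div_lt_one hN]
    have : (k : ℝ) + 1 ≤ l.length := by exact_mod_cast hk
    linarith [hθ.2]
  have hfloor : ∀ (k : ℕ) (θ : ℝ), θ ∈ Ico (0 : ℝ) 1 → ⌊(l.length : ℝ) * (((k : ℝ) + θ) / l.length)⌋₊ = k := by
    intro k θ hθ
    rw [mul_div_cancel₀ _ hN.ne']
    exact Nat.floor_eq_on_Ico k _ ⟨by linarith [hθ.1], by linarith [hθ.2]⟩
  refine ⟨hl, fun k hk heq ↦ ?_, fun i j hi hj hij ↦ ?_⟩
  · -- a degenerate edge makes the loop constant on `[k/N, (k+1)/N)`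
    obtain ⟨h0, e0⟩ := hparam k hk 0 ⟨le_rfl, one_pos⟩
    obtain ⟨h1, e1⟩ := hparam k hk (1 / 2) ⟨by norm_num, by norm_num⟩
    have : ((k : ℝ) + 0) / l.length = ((k : ℝ) + 1 / 2) / l.length := by
      refine hinj h0 h1 ?_
      rw [e0, e1, ← heq]
      simp
    rw [div_eq_div_iff hN.ne' hN.ne'] at this
    nlinarith
  · rw [Set.disjoint_left]
    rintro x ⟨θ, hθ, rfl⟩ ⟨θ', hθ', hx⟩
    obtain ⟨h0, e0⟩ := hparam i hi θ hθ
    obtain ⟨h1, e1⟩ := hparam j hj θ' hθ'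
    have heq : ((i : ℝ) + θ) / l.length = ((j : ℝ) + θ') / l.length :=
      hinj h0 h1 (by rw [e0, e1]; exact hx.symm)
    have := congrArg (fun s : ℝ ↦ ⌊(l.length : ℝ) * s⌋₊) heq
    simp only [hfloor i θ hθ, hfloor j θ' hθ'] at this
    exact hij this

/-- **A strictly star-shaped polygon with total turning `< 4π` is simple.** If every cyclic edge
`[v_k, v_{k+1}]` is seen strictly counterclockwise from `z` (`cross > 0`), subtends an acute
angle at `z` (`⟪v_k - z, v_{k+1} - z⟫ > 0`), and `∑_k cross_k / ⟪·,·⟫_k < 4π`, then the closed polygon through `l` is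
simple. (The winding number about `z` is an integer `≥ 1` equal to `(2π)⁻¹ ∑ arg w_k ≤
(2π)⁻¹ ∑ tan (arg w_k) < 2`, so it is `1`; then the imaginary part of the logarithm along the
loop pins every parameter: two parameters with the same point have logarithms differing by a
multiple of `2πi` with imaginary part in `(-2π, 2π)`.) [folklore] -/
theorem isSimpleClosedPolygon_of_cross_pos (hl : 0 < l.length)
    (h : ∀ (k : ℕ) (hk : k < l.length),
      0 < cross (l[k] - z) (l[(k + 1) % l.length]'(Nat.mod_lt _ hl) - z))
    (hd : ∀ (k : ℕ) (hk : k < l.length),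
      0 < inner ℝ (l[k] - z) (l[(k + 1) % l.length]'(Nat.mod_lt _ hl) - z))
    (hsum : ∑ k ∈ Finset.range l.length,
      cross (l[k % l.length]'(Nat.mod_lt _ hl) - z) (l[(k + 1) % l.length]'(Nat.mod_lt _ hl) - z) /
        inner ℝ (l[k % l.length]'(Nat.mod_lt _ hl) - z) (l[(k + 1) % l.length]'(Nat.mod_lt _ hl) - z)
      < 4 * Real.pi) :
    IsSimpleClosedPolygon l := by
  have hN : (0 : ℝ) < l.length := by exact_mod_cast hl
  set w := edgeRatio l z hl with hw
  -- `arg w_k ≤ cross_k / ⟪·,·⟫_k`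
  have harg_le : ∀ k, arg (w k) ≤
      cross (l[k % l.length]'(Nat.mod_lt _ hl) - z) (l[(k + 1) % l.length]'(Nat.mod_lt _ hl) - z) /
        inner ℝ (l[k % l.length]'(Nat.mod_lt _ hl) - z) (l[(k + 1) % l.length]'(Nat.mod_lt _ hl) - z) := by
    intro k
    have hk := Nat.mod_lt k hl
    have e : l[(k % l.length + 1) % l.length]'(Nat.mod_lt _ hl) =
        l[(k + 1) % l.length]'(Nat.mod_lt _ hl) := getElem_congr_idx (Nat.mod_add_mod _ _ _)
    have hc := h (k % l.length) hk
    have hdd := hd (k % l.length) hk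
    rw [e] at hc hdd
    have hne : l[k % l.length]'(Nat.mod_lt _ hl) - z ≠ 0 := by
      intro h0; rw [h0, cross] at hc; simp at hc
    have hns : 0 < Complex.normSq (l[k % l.length]'(Nat.mod_lt _ hl) - z) := Complex.normSq_pos.2 hne
    have hre : 0 < (w k).re := by
      simp only [hw, edgeRatio]; rw [re_div_eq_inner_div]; exact div_pos hdd hns
    have him : 0 ≤ (w k).im := by
      simp only [hw, edgeRatio]; rw [im_div_eq_cross_div]; exact (div_pos hc hns).le
    refine (arg_le_im_div_re hre him).trans (le_of_eq ?_)
    simp only [hw, edgeRatio]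
    rw [re_div_eq_inner_div, im_div_eq_cross_div, div_div_div_cancel_right₀ hns.ne']
  -- hence `wind = 1` and `∑ arg w_k = 2π`
  have hsum_eq := sum_arg_edgeRatio_eq hl h
  have hwind1 : wind (fun t ↦ polygonLoop l t - z) = 1 := by
    have h1 := one_le_wind_polygonLoop_sub hl h
    have h2 : (wind (fun t ↦ polygonLoop l t - z) : ℝ) < 2 := by
      have : ∑ k ∈ Finset.range l.length, arg (w k) < 4 * Real.pi :=
        (Finset.sum_le_sum fun k _ ↦ harg_le k).trans_lt hsum
      rw [hsum_eq] at this
      nlinarith [Real.pi_pos]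
    have h2' : wind (fun t ↦ polygonLoop l t - z) < 2 := by exact_mod_cast h2
    omega
  have htotal : ∑ k ∈ Finset.range l.length, arg (w k) = 2 * Real.pi := by
    rw [hsum_eq, hwind1]; simp
  -- the argument bookkeeping along the loop
  have hpart : ∀ k, (vertexLog l z hl k - vertexLog l z hl 0).im =
      ∑ r ∈ Finset.range k, arg (w r) := im_vertexLog_sub_eq_sum hl
  have hargpos : ∀ k, 0 < arg (w k) := arg_edgeRatio_pos hl h
  -- decomposition of a parameter `t ∈ [0, 1)`: edge `k < N`, fraction `s ∈ [0, 1)`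
  have hdecomp : ∀ t ∈ Ico (0 : ℝ) 1, ∃ (k : ℕ) (s : ℝ), k < l.length ∧ s ∈ Ico (0 : ℝ) 1 ∧
      polygonLog l z hl t = vertexLog l z hl k + Complex.log (edgeInterp l z hl k s) ∧
      t = (k + s) / l.length := by
    intro t ht
    have ht0 : 0 ≤ (l.length : ℝ) * t := mul_nonneg hN.le ht.1
    refine ⟨⌊(l.length : ℝ) * t⌋₊, l.length * t - ⌊(l.length : ℝ) * t⌋₊,
      (Nat.floor_lt ht0).2 (by nlinarith [ht.2]), ⟨?_, ?_⟩, rfl, ?_⟩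
    · have := Nat.floor_le ht0; linarith
    · have := Nat.lt_floor_add_one ((l.length : ℝ) * t); linarith
    · field_simp; ring
  -- imaginary part of the logarithm at such a parameter, with its bounds
  have him_bounds : ∀ (k : ℕ) (s : ℝ), s ∈ Ico (0 : ℝ) 1 →
      (∑ r ∈ Finset.range k, arg (w r)) ≤
        (vertexLog l z hl k + Complex.log (edgeInterp l z hl k s) - vertexLog l z hl 0).im ∧
      (vertexLog l z hl k + Complex.log (edgeInterp l z hl k s) - vertexLog l z hl 0).im <
        ∑ r ∈ Finset.range (k + 1), arg (w r) := by
    intro k s hs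
    have hb := arg_lineInterp_lt (im_edgeRatio_pos hl h k) hs
    rw [add_sub_right_comm, Complex.add_im, hpart k, Complex.log_im, Finset.sum_range_succ]
    change 0 ≤ arg (edgeInterp l z hl k s) ∧ arg (edgeInterp l z hl k s) < arg (w k) at hb
    constructor <;> linarith [hb.1, hb.2]
  have hmono : ∀ {i j : ℕ}, i ≤ j → ∑ r ∈ Finset.range i, arg (w r) ≤ ∑ r ∈ Finset.range j, arg (w r) :=
    fun hij ↦ Finset.sum_le_sum_of_subset_of_nonneg (Finset.range_mono hij)
      fun r _ _ ↦ (hargpos r).le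
  -- injectivity
  refine IsSimpleClosedPolygon.of_injOn hl fun t ht t' ht' heq ↦ ?_
  obtain ⟨k, s, hk, hs, hLt, rfl⟩ := hdecomp t ht
  obtain ⟨k', s', hk', hs', hLt', rfl⟩ := hdecomp t' ht'
  -- the two logarithms have the same exponential, so differ by `2πi n`
  have hexp : Complex.exp (polygonLog l z hl ((k + s) / l.length)) =
      Complex.exp (polygonLog l z hl ((k' + s') / l.length)) := by
    rw [exp_polygonLog hl h ⟨ht.1, ht.2.le⟩, exp_polygonLog hl h ⟨ht'.1, ht'.2.le⟩, heq]
  obtain ⟨n, hn⟩ := Complex.exp_eq_exp_iff_exists_int.1 hexp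
  -- imaginary parts: `|difference| < 2π` forces `n = 0`
  have hb := him_bounds k s hs
  have hb' := him_bounds k' s' hs'
  rw [← hLt] at hb
  rw [← hLt'] at hb'
  have hlek : ∑ r ∈ Finset.range (k + 1), arg (w r) ≤ 2 * Real.pi := htotal ▸ hmono hk
  have hlek' : ∑ r ∈ Finset.range (k' + 1), arg (w r) ≤ 2 * Real.pi := htotal ▸ hmono hk'
  have h0k : 0 ≤ ∑ r ∈ Finset.range k, arg (w r) := Finset.sum_nonneg fun r _ ↦ (hargpos r).le
  have h0k' : 0 ≤ ∑ r ∈ Finset.range k', arg (w r) := Finset.sum_nonneg fun r _ ↦ (hargpos r).le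
  have hn0 : n = 0 := by
    have hi := congrArg Complex.im hn
    simp only [Complex.add_im, Complex.mul_im, Complex.intCast_re, Complex.intCast_im, zero_mul,
      add_zero, Complex.mul_re, Complex.re_ofNat, Complex.im_ofNat, Complex.ofReal_re,
      Complex.ofReal_im, Complex.I_re, Complex.I_im, mul_zero, sub_zero, mul_one] at hi
    -- `im L(t) - im L(t') = 2π n` with both in `[0, 2π)` relative to `im Λ_0`
    have hlt1 : ((n : ℝ) * (2 * Real.pi)) < 2 * Real.pi := by
      have := Complex.sub_im (polygonLog l z hl ((↑k + s) / ↑l.length)) (vertexLog l z hl 0)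
      have := Complex.sub_im (polygonLog l z hl ((↑k' + s') / ↑l.length)) (vertexLog l z hl 0)
      nlinarith [hb.1, hb.2, hb'.1, hb'.2, Real.pi_pos]
    have hgt1 : -(2 * Real.pi) < (n : ℝ) * (2 * Real.pi) := by
      have := Complex.sub_im (polygonLog l z hl ((↑k + s) / ↑l.length)) (vertexLog l z hl 0)
      have := Complex.sub_im (polygonLog l z hl ((↑k' + s') / ↑l.length)) (vertexLog l z hl 0)
      nlinarith [hb.1, hb.2, hb'.1, hb'.2, Real.pi_pos]
    have h1 : (n : ℝ) < 1 := by nlinarith [Real.pi_pos]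
    have h2 : (-1 : ℝ) < n := by nlinarith [Real.pi_pos]
    have h1' : n < 1 := by exact_mod_cast h1
    have h2' : -1 < n := by exact_mod_cast h2
    omega
  -- so the logarithms are equal, hence the edge points and the parameters
  rw [hn0] at hn
  simp only [Int.cast_zero, zero_mul, add_zero] at hn
  -- equal logs ⇒ equal imaginary parts ⇒ same edge
  have hkk : k = k' := by
    by_contra hne
    have hi := congrArg Complex.im hn
    rcases lt_or_gt_of_ne hne with hlt | hlt
    · have := hmono (Nat.succ_le_of_lt hlt)
      have e1 := Complex.sub_im (polygonLog l z hl ((↑k + s) / ↑l.length)) (vertexLog l z hl 0)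
      have e2 := Complex.sub_im (polygonLog l z hl ((↑k' + s') / ↑l.length)) (vertexLog l z hl 0)
      linarith [hb.2, hb'.1]
    · have := hmono (Nat.succ_le_of_lt hlt)
      have e1 := Complex.sub_im (polygonLog l z hl ((↑k + s) / ↑l.length)) (vertexLog l z hl 0)
      have e2 := Complex.sub_im (polygonLog l z hl ((↑k' + s') / ↑l.length)) (vertexLog l z hl 0)
      linarith [hb.1, hb'.2]
  subst hkk
  -- same edge: equal logs ⇒ equal interpolation points ⇒ `s = s'`
  have hq : edgeInterp l z hl k s = edgeInterp l z hl k s' := by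
    rw [hLt, hLt'] at hn
    have := add_left_cancel hn
    have h1 := congrArg Complex.exp this
    rwa [Complex.exp_log (Complex.slitPlane_ne_zero (edgeInterp_mem_slitPlane hl h k hs.1)),
      Complex.exp_log (Complex.slitPlane_ne_zero (edgeInterp_mem_slitPlane hl h k hs'.1))] at h1
  have hw1 : w k - 1 ≠ 0 := by
    intro h0
    have := im_edgeRatio_pos hl h k
    rw [sub_eq_zero] at h0
    rw [← hw, h0] at this
    simp at this
  have hss : s = s' := by
    simp only [edgeInterp] at hq
    have : ((s : ℂ) - s') * (w k - 1) = 0 := by linear_combination hq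
    rcases mul_eq_zero.1 this with h0 | h0
    · exact_mod_cast sub_eq_zero.1 h0
    · exact absurd h0 hw1
  rw [hss]

/-- A unit step sweeps a small area: `‖v - u‖ ≤ 1` gives `cross u v ≤ ‖u‖`. [folklore] -/
theorem cross_le_norm {u v : ℂ} (hvu : ‖v - u‖ ≤ 1) : cross u v ≤ ‖u‖ := by
  rw [cross_eq_im]
  calc (starRingEnd ℂ u * (v - u)).im ≤ |(starRingEnd ℂ u * (v - u)).im| := le_abs_self _
    _ ≤ ‖starRingEnd ℂ u * (v - u)‖ := Complex.abs_im_le_norm _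
    _ = ‖u‖ * ‖v - u‖ := by rw [norm_mul, Complex.norm_conj]
    _ ≤ ‖u‖ := by nlinarith [norm_nonneg u, norm_nonneg (v - u)]

/-- **Convenient form for lattice polygons far from `z`**: if every vertex is at distance `≥ r`
from `z` (`r > 1`), consecutive vertices are at distance `≤ 1`, every edge is seen strictly
counterclockwise from `z`, and the number of vertices is `< 4π (r - 1)`, the polygon is simple
(each `cross_k/⟪·,·⟫_k ≤ 1/(r - 1)`). [folklore] -/
theorem isSimpleClosedPolygon_of_cross_pos_of_le_norm (hl : 0 < l.length) {r : ℝ} (hr : 1 < r)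
    (hnorm : ∀ (k : ℕ) (hk : k < l.length), r ≤ ‖l[k] - z‖)
    (hstep : ∀ (k : ℕ) (hk : k < l.length), ‖l[(k + 1) % l.length]'(Nat.mod_lt _ hl) - l[k]‖ ≤ 1)
    (h : ∀ (k : ℕ) (hk : k < l.length),
      0 < cross (l[k] - z) (l[(k + 1) % l.length]'(Nat.mod_lt _ hl) - z))
    (hN : (l.length : ℝ) < 4 * Real.pi * (r - 1)) : IsSimpleClosedPolygon l := by
  -- per-edge bounds
  have key : ∀ (k : ℕ) (hk : k < l.length),
      0 < inner ℝ (l[k] - z) (l[(k + 1) % l.length]'(Nat.mod_lt _ hl) - z) ∧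
      cross (l[k] - z) (l[(k + 1) % l.length]'(Nat.mod_lt _ hl) - z) /
        inner ℝ (l[k] - z) (l[(k + 1) % l.length]'(Nat.mod_lt _ hl) - z) ≤ 1 / (r - 1) := by
    intro k hk
    have hd : l[(k + 1) % l.length]'(Nat.mod_lt _ hl) - z - (l[k] - z) =
        l[(k + 1) % l.length]'(Nat.mod_lt _ hl) - l[k] := by ring
    have hvu : ‖l[(k + 1) % l.length]'(Nat.mod_lt _ hl) - z - (l[k] - z)‖ ≤ 1 := hd ▸ hstep k hk
    have hun : r ≤ ‖l[k] - z‖ := hnorm k hk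
    have hu1 : 1 < ‖l[k] - z‖ := hr.trans_le hun
    have hdot := norm_sq_sub_norm_le_inner hvu
    have hcross := cross_le_norm hvu
    have hdpos : 0 < inner ℝ (l[k] - z) (l[(k + 1) % l.length]'(Nat.mod_lt _ hl) - z) := by nlinarith
    refine ⟨hdpos, ?_⟩
    rw [div_le_div_iff₀ hdpos (by linarith), one_mul]
    nlinarith [h k hk]
  refine isSimpleClosedPolygon_of_cross_pos hl h (fun k hk ↦ (key k hk).1) ?_
  calc ∑ k ∈ Finset.range l.length,
        cross (l[k % l.length]'(Nat.mod_lt _ hl) - z) (l[(k + 1) % l.length]'(Nat.mod_lt _ hl) - z) /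
          inner ℝ (l[k % l.length]'(Nat.mod_lt _ hl) - z) (l[(k + 1) % l.length]'(Nat.mod_lt _ hl) - z)
      ≤ ∑ _k ∈ Finset.range l.length, 1 / (r - 1) := by
        refine Finset.sum_le_sum fun k hk ↦ ?_
        have hk' : k < l.length := Finset.mem_range.1 hk
        have e : l[k % l.length]'(Nat.mod_lt _ hl) = l[k] := getElem_congr_idx (Nat.mod_eq_of_lt hk')
        rw [e]
        exact (key k hk').2
    _ = l.length * (1 / (r - 1)) := by rw [Finset.sum_const, Finset.card_range, nsmul_eq_mul]
    _ < 4 * Real.pi := by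
        rw [mul_one_div, div_lt_iff₀ (by linarith)]
        linarith

end Polygon

end Literature.Probability.RandomPlanarGeometry
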